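import Summits.ValiantsHypothesis.ValiantsHypothesis.Theorems.KPlusLogSqLawTropicalBLexShiftOne
import Summits.ValiantsHypothesis.ValiantsHypothesis.Theorems.KPlusLogSqLawTropicalBLexShiftStructureTwo

/-!
# Route «KPlusLogSqLaw», crux `TropicalB` (stmt-ValiantsHypothesis-19771) — LEX-NT, part 11b: THE SECOND LEX CORE LAW when `A`'s top cell is not shared
# no design has dominant terms `3·2^{m−1} ≺ 3²·1^{m−2} ≺ 3²·2·0^{m−3}` (`m ≥ 5`) unless the top cell of the first term is also a cell of the second or the third

HONEST FRAMING.  Structure law for dominance designs of any format (seat val-sym-trop-p5 g14, 2026-08-28; cell `pub-symmetroid`,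
`--supports stmt-ValiantsHypothesis-19771 --as helper`), the sequel of `…TropicalBLexShiftOne` (generic case `p ∉ {q₁, q₂, r₁, r₂}`): the same
assembly (structure `…TropicalBLexShiftStructureTwo` + arc lemma + shift closure) under the weaker hypothesis `β p ≠ α p ∧ γ p ≠ α p` — `A`'s top cell
is not a cell of `B` or `C` (automatic when `p` is not a top column of `B`, `C`).  What remains of the conjectured second lex core law «`T_1` never
realised for `m ≥ 5`» is exactly the SHARED-CELL case (verified exhaustively at `m = 5, 6`, seat memo LEX-NT-g14 §5); so again NO census corollary
is drawn here.  Nothing here bears on `TropicalB` in its window, `WeakLifting`, DoorA26 / DoorA34, `MatrixDescartes` (stmt-ValiantsHypothesis-18050) or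
VP ≠ VNP.  [this cell]
-/

set_option linter.dupNamespace false
set_option autoImplicit false

namespace Summit.ValiantsHypothesis.ValiantsHypothesis.Theorems.KPlusLogSqLaw

namespace LexCore

open Summit.ValiantsHypothesis.ValiantsHypothesis.Theorems.MatrixDescartes.Negative
open Finset

variable {m K : ℕ}

/-- **THE SECOND LEX CORE LAW when `A`'s top cell is not shared** (see the module docstring). [this cell] -/
theorem shift_one_law (hm : 5 ≤ m) (d : Fin K → ℕ) (v ε : Fin m → Fin m → Fin K → ℤ) (c₀ c₁ c₂ c₃ : Fin K)
    (h01 : d c₀ < d c₁) (h12 : d c₁ < d c₂) (h23 : d c₂ < d c₃)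
    {α β γ : Equiv.Perm (Fin m)} {lA lB lC : Fin m → Fin K} (p q₁ q₂ r₁ r₂ y : Fin m)
    (hq : q₁ ≠ q₂) (hr : r₁ ≠ r₂) (hnb : β p ≠ α p) (hnc : γ p ≠ α p) (hy1 : y ≠ r₁) (hy2 : y ≠ r₂)
    (hlAp : lA p = c₃) (hlA : ∀ b, b ≠ p → lA b = c₂)
    (hlB1 : lB q₁ = c₃) (hlB2 : lB q₂ = c₃) (hlB : ∀ b, b ≠ q₁ → b ≠ q₂ → lB b = c₁)
    (hlC1 : lC r₁ = c₃) (hlC2 : lC r₂ = c₃) (hlCy : lC y = c₂) (hlC : ∀ b, b ≠ r₁ → b ≠ r₂ → b ≠ y → lC b = c₀)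
    {θA θB θC : ℤ} (hAB : θA < θB) (hBC : θB < θC)
    (hA : IsDominant d v ε θA (α, lA)) (hB : IsDominant d v ε θB (β, lB)) (hC : IsDominant d v ε θC (γ, lC)) : False := by
  classical
  have hc23 : c₂ ≠ c₃ := fun h => (ne_of_lt h23) (by rw [h])
  have hc13 : c₁ ≠ c₃ := fun h => (ne_of_lt (h12.trans h23)) (by rw [h])
  have hc03 : c₀ ≠ c₃ := fun h => (ne_of_lt ((h01.trans h12).trans h23)) (by rw [h])
  have hc02 : c₀ ≠ c₂ := fun h => (ne_of_lt (h01.trans h12)) (by rw [h])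
  set π := α⁻¹ * β with hπdef
  set ρ := α⁻¹ * γ with hρdef
  -- structure from the pairwise laws
  obtain ⟨hπmv, hπcyc⟩ := shift_pi_structure' d v ε hAB hA hB c₁ c₂ c₃ h12 h23 p q₁ q₂ hq hnb hlAp hlA hlB1 hlB2 hlB
  obtain ⟨⟨hr1, hr2⟩, hρ⟩ := shift_rho_structure' d v ε (hAB.trans hBC) hA hC c₀ c₂ c₃ (h01.trans h12) h23 p r₁ r₂ y hr hnc hy1 hy2
    hlAp hlA hlC1 hlC2 hlCy hlC
  have hρp : ρ p ≠ p := by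
    intro h; apply hnc
    have : α (ρ p) = α p := by rw [h]
    simpa [hρdef, Equiv.Perm.mul_apply] using this
  have hfix : ∀ b, ρ b = b → b = y ∧ y ≠ p := by
    intro b hb
    rcases hρ b with h | h
    · -- `b` in the cycle of `p` and fixed: then `p = b` is fixed, against `γ p ≠ α p`
      have hpb : p = b := h.eq_of_right hb
      subst hpb
      exact absurd hb hρp
    · exact ⟨h.1, h.2.2⟩
  have hcoin : ∀ b, ρ b = π b → b = r₁ ∨ b = r₂ ∨ (b = y ∧ y ≠ q₁ ∧ y ≠ q₂) := by
    intro b hb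
    have hbg : β b = γ b := by
      have : α (π b) = α (ρ b) := by rw [hb]
      simpa [hπdef, hρdef, Equiv.Perm.mul_apply] using this
    rcases shift_coincidence d v ε hBC hB hC c₀ c₁ c₂ c₃ h01 h12 h23 q₁ q₂ r₁ r₂ y hlB1 hlB2 hlB hlCy hlC b hbg with h | ⟨h1, h2, h3⟩
    · rcases h with h | h
      · exact Or.inl h
      · exact Or.inr (Or.inl h)
    · subst h1; exact Or.inr (Or.inr ⟨rfl, h2, h3⟩)
  -- the `π`-clock
  obtain ⟨pos, hinj, hlt, hstep, hwrap⟩ := exists_order_wrap (bs := p) hπmv hπcyc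
  set D : Fin m → Fin m → ℕ := fun c x => if pos c ≤ pos x then pos x - pos c else pos x + m - pos c with hDdef
  have hD : ∀ c x, D c x = if pos c ≤ pos x then pos x - pos c else pos x + m - pos c := fun c x => rfl
  obtain ⟨hDlt, hD0, hDinj⟩ := clock_basic pos hinj hlt D hD
  have hDstep := clock_step π pos hlt hstep hwrap D hD
  -- the cheap arc
  obtain ⟨b, hbmv, hcount⟩ := arc_lemma hm π ρ pos hinj hlt hstep hwrap p q₁ q₂ r₁ r₂ y hπcyc hfix hcoin D hD
  -- the switched matching along the arc `[ρ b, b]`: `C` at `b`, `B` on the tails of the arc, `A` elsewhere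
  set T : Fin 3 → Equiv.Perm (Fin m) × (Fin m → Fin K) := ![(α, lA), (β, lB), (γ, lC)] with hT
  have T0 : T 0 = (α, lA) := rfl
  have T1 : T 1 = (β, lB) := rfl
  have T2 : T 2 = (γ, lC) := rfl
  set sM : Fin m → Fin 3 := fun x => if x = b then 2 else if D (ρ b) x < D (ρ b) b then 1 else 0 with hsM
  -- its row map, read through `α⁻¹`, permutes clock distances from `ρ b`
  have hrow : ∀ x, D (ρ b) (α⁻¹ ((T (sM x)).1 x)) =
      (if x = b then 0 else if D (ρ b) x < D (ρ b) b then D (ρ b) x + 1 else D (ρ b) x) := by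
    intro x
    by_cases hxb : x = b
    · have hs : sM x = 2 := by simp only [hsM]; rw [if_pos hxb]
      rw [hs, if_pos hxb, T2, hxb]
      show D (ρ b) ((α⁻¹ : Equiv.Perm (Fin m)) (γ b)) = 0
      rw [(hD0 _ _).mpr]; rw [hρdef, Equiv.Perm.mul_apply]
    · by_cases hin : D (ρ b) x < D (ρ b) b
      · have hs : sM x = 1 := by simp only [hsM]; rw [if_neg hxb, if_pos hin]
        rw [hs, if_neg hxb, if_pos hin, T1]
        show D (ρ b) ((α⁻¹ : Equiv.Perm (Fin m)) (β x)) = D (ρ b) x + 1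
        have e := hDstep (ρ b) x
        have : (α⁻¹ : Equiv.Perm (Fin m)) (β x) = π x := by rw [hπdef, Equiv.Perm.mul_apply]
        rw [this, e]
        have := hDlt (ρ b) b
        rw [if_neg (by omega)]
      · have hs : sM x = 0 := by simp only [hsM]; rw [if_neg hxb, if_neg hin]
        rw [hs, if_neg hxb, if_neg hin, T0]
        show D (ρ b) ((α⁻¹ : Equiv.Perm (Fin m)) (α x)) = D (ρ b) x
        simp
  have hMinj : Function.Injective fun x => (T (sM x)).1 x := by
    intro x x' h
    have h' : D (ρ b) (α⁻¹ ((T (sM x)).1 x)) = D (ρ b) (α⁻¹ ((T (sM x')).1 x')) := by simp only at h; rw [h]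
    rw [hrow x, hrow x'] at h'
    have hL1 : 1 ≤ D (ρ b) b := by
      by_contra h0
      exact hbmv ((hD0 (ρ b) b).mp (by omega))
    have Fx : D (ρ b) x = D (ρ b) b → x = b := fun e => hDinj _ _ _ e
    have Fx' : D (ρ b) x' = D (ρ b) b → x' = b := fun e => hDinj _ _ _ e
    rcases eq_or_ne x b with hxb | hxb <;> rcases eq_or_ne x' b with hx'b | hx'b
    · rw [hxb, hx'b]
    · exfalso
      rw [if_pos hxb, if_neg hx'b] at h'
      split_ifs at h' with h2
      all_goals omega
    · exfalso
      rw [if_neg hxb, if_pos hx'b] at h'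
      split_ifs at h' with h2
      all_goals omega
    · rw [if_neg hxb, if_neg hx'b] at h'
      split_ifs at h' with h2 h3 h3
      · exact hDinj (ρ b) x x' (by omega)
      · exfalso; exact hx'b (Fx' (by omega))
      · exfalso; exact hxb (Fx (by omega))
      · exact hDinj (ρ b) x x' h'
  -- it differs from `A` at the column `b`
  have hMne : ∃ x, (T (sM x)).1 x ≠ α x ∨ (T (sM x)).2 x ≠ lA x := by
    refine ⟨b, Or.inl ?_⟩
    have hs : sM b = 2 := by simp [hsM]
    rw [hs, T2]
    show γ b ≠ α b
    intro h
    apply hbmv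
    rw [hρdef, Equiv.Perm.mul_apply, Equiv.Perm.inv_eq_iff_eq]; exact h
  -- its top cells: at most `[b ∈ R] + [q₁, q₂ tails in the arc] + [p off the arc] ≤ 1`
  have hM3 : (univ.filter fun x => (T (sM x)).2 x = c₃).card ≤ 1 := by
    refine le_trans ?_ hcount
    -- the filter is contained in the union of the (at most) four singletons
    have hsub : (univ.filter fun x => (T (sM x)).2 x = c₃) ⊆
        ((if D (ρ b) q₁ < D (ρ b) b then {q₁} else ∅) ∪ (if D (ρ b) q₂ < D (ρ b) b then {q₂} else ∅) ∪
          (if b = r₁ ∨ b = r₂ then {b} else ∅) ∪ (if D (ρ b) p ≤ D (ρ b) b then ∅ else {p})) := by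
      intro x hx
      simp only [Finset.mem_filter, Finset.mem_univ, true_and] at hx
      simp only [Finset.mem_union]
      by_cases hxb : x = b
      · -- `C` at `b`: top iff `b ∈ R`
        have hs : sM x = 2 := by simp only [hsM]; rw [if_pos hxb]
        rw [hs, T2] at hx
        change lC x = c₃ at hx
        subst hxb
        have hbR : x = r₁ ∨ x = r₂ := by
          by_contra hnot; push Not at hnot
          by_cases hxy : x = y
          · rw [hxy, hlCy] at hx; exact hc23 hx
          · rw [hlC x hnot.1 hnot.2 hxy] at hx; exact hc03 hx
        refine Or.inl (Or.inr ?_)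
        rw [if_pos hbR]; exact Finset.mem_singleton_self _
      · by_cases hin : D (ρ b) x < D (ρ b) b
        · -- `B` on a tail: top iff `x ∈ Q`
          have hs : sM x = 1 := by simp only [hsM]; rw [if_neg hxb, if_pos hin]
          rw [hs, T1] at hx
          change lB x = c₃ at hx
          have hxQ : x = q₁ ∨ x = q₂ := by
            by_contra hnot; push Not at hnot
            rw [hlB x hnot.1 hnot.2] at hx; exact hc13 hx
          rcases hxQ with hx1 | hx2
          · subst hx1; refine Or.inl (Or.inl (Or.inl ?_)); rw [if_pos hin]; exact Finset.mem_singleton_self _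
          · subst hx2; refine Or.inl (Or.inl (Or.inr ?_)); rw [if_pos hin]; exact Finset.mem_singleton_self _
        · -- `A` off the arc: top iff `x = p`
          have hs : sM x = 0 := by simp only [hsM]; rw [if_neg hxb, if_neg hin]
          rw [hs, T0] at hx
          change lA x = c₃ at hx
          have hxp : x = p := by
            by_contra hnot; rw [hlA x hnot] at hx; exact hc23 hx
          subst hxp
          refine Or.inr ?_
          have hnot : ¬ D (ρ b) x ≤ D (ρ b) b := by
            intro hle
            rcases lt_or_eq_of_le hle with h | h
            · exact hin h
            · exact hxb (hDinj _ _ _ h)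
          rw [if_neg hnot]; exact Finset.mem_singleton_self _
    refine le_trans (Finset.card_le_card hsub) ?_
    refine le_trans (Finset.card_union_le _ _) ?_
    refine le_trans (Nat.add_le_add_right (Finset.card_union_le _ _) _) ?_
    refine le_trans (Nat.add_le_add_right (Nat.add_le_add_right (Finset.card_union_le _ _) _) _) ?_
    have e1 : (if D (ρ b) q₁ < D (ρ b) b then ({q₁} : Finset (Fin m)) else ∅).card = (if D (ρ b) q₁ < D (ρ b) b then 1 else 0) := by
      split_ifs <;> simp
    have e2 : (if D (ρ b) q₂ < D (ρ b) b then ({q₂} : Finset (Fin m)) else ∅).card = (if D (ρ b) q₂ < D (ρ b) b then 1 else 0) := by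
      split_ifs <;> simp
    have e3 : (if b = r₁ ∨ b = r₂ then ({b} : Finset (Fin m)) else ∅).card = (if b = r₁ ∨ b = r₂ then 1 else 0) := by
      split_ifs <;> simp
    have e4 : (if D (ρ b) p ≤ D (ρ b) b then (∅ : Finset (Fin m)) else {p}).card = (if D (ρ b) p ≤ D (ρ b) b then 0 else 1) := by
      split_ifs <;> simp
    rw [e1, e2, e3, e4]
  -- shapes in the counted form
  have hlA' : ∀ x, lA x = c₂ ∨ lA x = c₃ := fun x => by
    by_cases hx : x = p
    · exact Or.inr (by rw [hx, hlAp])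
    · exact Or.inl (hlA x hx)
  have hA3 : (univ.filter fun x => lA x = c₃).card = 1 := by
    rw [Finset.card_eq_one]; refine ⟨p, ?_⟩; ext x
    simp only [Finset.mem_filter, Finset.mem_univ, true_and, Finset.mem_singleton]
    constructor
    · intro h; by_contra hx; rw [hlA x hx] at h; exact hc23 h
    · intro h; rw [h, hlAp]
  have hlB' : ∀ x, lB x = c₁ ∨ lB x = c₃ := fun x => by
    by_cases h1 : x = q₁
    · exact Or.inr (by rw [h1, hlB1])
    · by_cases h2 : x = q₂
      · exact Or.inr (by rw [h2, hlB2])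
      · exact Or.inl (hlB x h1 h2)
  have hB3 : (univ.filter fun x => lB x = c₃).card = 1 + 1 := by
    have : (univ.filter fun x => lB x = c₃) = {q₁, q₂} := by
      ext x
      simp only [Finset.mem_filter, Finset.mem_univ, true_and, Finset.mem_insert, Finset.mem_singleton]
      constructor
      · intro h; by_contra hnot; push Not at hnot; rw [hlB x hnot.1 hnot.2] at h; exact hc13 h
      · rintro (h | h)
        · rw [h, hlB1]
        · rw [h, hlB2]
    rw [this, Finset.card_insert_of_notMem (by simpa using hq), Finset.card_singleton]
  have hlC' : ∀ x, lC x = c₀ ∨ lC x = c₂ ∨ lC x = c₃ := fun x => by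
    by_cases h1 : x = r₁
    · exact Or.inr (Or.inr (by rw [h1, hlC1]))
    · by_cases h2 : x = r₂
      · exact Or.inr (Or.inr (by rw [h2, hlC2]))
      · by_cases h3 : x = y
        · exact Or.inr (Or.inl (by rw [h3, hlCy]))
        · exact Or.inl (hlC x h1 h2 h3)
  have hC3 : (univ.filter fun x => lC x = c₃).card = 1 + 1 := by
    have : (univ.filter fun x => lC x = c₃) = {r₁, r₂} := by
      ext x
      simp only [Finset.mem_filter, Finset.mem_univ, true_and, Finset.mem_insert, Finset.mem_singleton]
      constructor
      · intro h; by_contra hnot; push Not at hnot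
        by_cases h3 : x = y
        · rw [h3, hlCy] at h; exact hc23 h
        · rw [hlC x hnot.1 hnot.2 h3] at h; exact hc03 h
      · rintro (h | h)
        · rw [h, hlC1]
        · rw [h, hlC2]
    rw [this, Finset.card_insert_of_notMem (by simpa using hr), Finset.card_singleton]
  have hC2 : (univ.filter fun x => lC x = c₂).card = 1 := by
    rw [Finset.card_eq_one]; refine ⟨y, ?_⟩; ext x
    simp only [Finset.mem_filter, Finset.mem_univ, true_and, Finset.mem_singleton]
    constructor
    · intro h; by_contra hxy
      by_cases h1 : x = r₁
      · rw [h1, hlC1] at h; exact hc23 h.symm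
      · by_cases h2 : x = r₂
        · rw [h2, hlC2] at h; exact hc23 h.symm
        · rw [hlC x h1 h2 hxy] at h; exact hc02 h
    · intro h; rw [h, hlCy]
  exact shift_closure d v ε c₀ c₁ c₂ c₃ h01 h12 h23 1 (by omega) hlA' hA3 hlB' hB3 hlC' hC3 hC2 hAB hBC hA hB hC sM hMinj hMne hM3

end LexCore

end Summit.ValiantsHypothesis.ValiantsHypothesis.Theorems.KPlusLogSqLaw
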